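import Literature.Analysis.FluidPDE.ExtremeGrowthBoundsProofs
import Literature.Analysis.FluidPDE.ExtremeGrowthLqAPriori
import HarnessLib

/-!
# The Foias–Guillopé–Temam sup-norm a-priori bound on `T³` (primitive form) and the `q > 6`
line of the lower edge of the `L^q` blow-up window

Analysis/FluidPDE file, sibling of `ExtremeGrowthLqAPriori.lean` (which treats `2 < q ≤ 6`).

**What is published.** For a Leray–Hopf weak solution of the Navier–Stokes equations on the
torus, `∫₀ᵀ ‖Au‖^{2/3} < ∞` and consequently `u ∈ L¹(0,T;L^∞)` (Foias–Guillopé–Temam 1981;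
Robinson–Rodrigo–Sadowski 2016, Lemma 8.15, (8.6)–(8.7): divide the `H¹` balance
`d/dt‖∇u‖² + ‖Au‖² ≤ c‖∇u‖⁶` by `‖∇u‖⁴`, integrate, then Agmon's inequality
`‖u‖_∞ ≤ c‖∇u‖^{1/2}‖Au‖^{1/2}` and Young). In B. Protas' essay (2026, §4.1, eq. (50), p. 65)
the a-priori space–time bounds and Grönwall's lemma give, for `q > 6`, the LOWER EDGE of the
`L^q` blow-up window: a growth law `d/dt ‖u‖_{L^q} ≤ C ‖u‖_{L^q}^{(2q−3)/(q−3)}` cannot produce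
a finite-time singularity (for `q > 6` the relevant a-priori class is
`∫₀ᵀ ‖u‖_{L^q}^{q/(q−3)} < ∞`, from `L¹(0,T;L^∞)` and `L²(0,T;L⁶)` by Hölder:
`‖u‖_q^{q/(q−3)} ≤ ‖u‖_∞^{(q−6)/(q−3)} (‖u‖₆²)^{3/(q−3)}`, weights `(q−6)/(q−3) + 3/(q−3) = 1`).

**What is proved here** (classical solutions of the unforced system on `T^d`, `card d = 3`,
`ν > 0`, mean-zero velocity slices, on a window `[a, b]`, `a < b`). We avoid time integrals of
`‖u(t)‖_∞` altogether and work with PRIMITIVES, in the smooth-window form of the RRS16 proof with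
the potential `Ψ = (1 + ‖∇u‖₂²)⁻¹` in place of `−‖∇u‖₂⁻²`:
* `gradNormSqRate_le`: the `H¹` balance with half the dissipation kept,
  `d/dt ‖∇u‖₂² ≤ −ν‖Δu‖₂² + (27/(4π⁴ν³)) ‖∇u‖₂⁶` (Agmon with the explicit constant `4/π⁴` of
  `Torus.norm_pow_four_le_agmon_explicit`, Cauchy–Schwarz, Young);
* `nu_mul_integral_norm_laplacian_sq_le`: `ν‖Δu‖₂² ≤ (Ψ' + (27/(4π⁴ν³))‖∇u‖₂²)(1 + ‖∇u‖₂²)²`,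
  `Ψ' = −(d/dt‖∇u‖₂²)/(1 + ‖∇u‖₂²)²` (`fgtPotentialRate`);
* `norm_le_fgtSupBound`: the POINTWISE sup bound
  `‖u(t,x)‖ ≤ α_ν Ψ'(t) + β + γ_ν ‖∇u(t)‖₂²` with explicit `α_ν = √2/(4πν)`, `β = 3√2/(4π)`,
  `γ_ν = √2·27/(16π⁵ν⁴) + 3√2/(4π)` (Agmon + AM–GM) — the integrand of (8.7) is dominated by the
  derivative of the bounded primitive `fgtSupPrimitive = α_ν Ψ + β t − (γ_ν/ν) K(u(t))`
  (`hasDerivWithinAt_fgtSupPrimitive`, `fgtSupPrimitive_sub_le`: its increment over `[a, t]` is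
  `≤ α_ν + β(b − a) + (γ_ν/ν) K(u(a))`), which is the `L¹(0,T;L^∞)` bound in primitive form;
* the `q = ∞` endpoint of the lower edge: if `y ≥ 0` has one-sided derivatives
  `y' ≤ A y ‖u(t, x_t)‖` for some point `x_t` (e.g. `y(t) = max_x ‖u(t,x)‖` and `y' ≤ A y²`),
  then `y(t) ≤ y(a) exp(A (α_ν + β(b−a) + (γ_ν/ν) K(u(a))))`
  (`le_mul_exp_of_deriv_le_mul_norm`, `le_mul_exp_of_eq_norm_of_rate_le_sq`);
* the `6 < q < ∞` line of (50): if `y' ≤ A y (∫‖u(t)‖^q)^{1/(q−3)}` then `y` obeys the same kind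
  of bound with `γ_ν/ν + c/(2ν)` (`c = lSixEnstrophyConst`, `‖u‖₆² ≤ c ℰ`) in place of `γ_ν/ν`
  (`le_mul_exp_of_deriv_le_mul_rpow_integral`), and literally for `y = ‖u(·)‖_{L^q}` with
  `y' ≤ A y^{(2q−3)/(q−3)}` (`lqNorm_le_mul_exp_of_rate_le_rpow_edge_gt_six`).
Differentiability of the norm is a HYPOTHESIS of the edge theorems (as in the sibling file);
nothing here asserts that any flow realises any rate. The weak-solution generality of
Lemma 8.15 (epochs of regularity) is NOT covered.

## References

* C. Foias, C. Guillopé, R. Temam, *New a priori estimates for Navier–Stokes equations in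
  dimension 3*, Comm. PDE 6 (1981) 329–359. [FoiasGuillopeTemam1981]
* J. C. Robinson, J. L. Rodrigo, W. Sadowski, *The three-dimensional Navier–Stokes equations*,
  CUP 2016, Lemma 8.15, (8.6)–(8.7); Thm 1.20 (Agmon). [RobinsonRodrigoSadowskiCUP2016]
* B. Protas, *Systematic search for singularities in 3D Navier–Stokes flows* (essay, 2026), §4.1,
  eq. (50), p. 65. [Protas2026]
* D. Ayala, PhD thesis, McMaster 2014, App. A (A.3), (A.7)–(A.8) (the `H¹` balance, Agmon,
  Young with explicit constants). [Ayala2014Thesis]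
-/

noncomputable section

open Set MeasureTheory Real
open scoped InnerProductSpace RealInnerProductSpace

namespace Literature.Analysis.FluidPDE

open Literature.Analysis.FunctionSpaces

variable {d : Type*} [Fintype d] [DecidableEq d]

/-! ## File-private helpers: Cauchy–Schwarz for the trilinear term, Young, AM–GM -/

section Helpers

/-- `‖(u·∇)v (x)‖ ≤ ‖u(x)‖ (∑ᵢ ‖∂ᵢ v(x)‖²)^{1/2}` (file-private twin of the helper in
`ExtremeGrowthBoundsProofs.lean`). [cite: Ayala2014Thesis, App. A, proof of (A.7)] -/
private theorem norm_convect_le_norm_mul_sqrt_aux {u v : UnitAddTorus d → EuclideanSpace ℝ d}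
    (hv : Torus.IsSmooth v) (x : UnitAddTorus d) :
    ‖Torus.convect u v x‖ ≤ ‖u x‖ * Real.sqrt (∑ i, ‖Torus.partialDeriv i v x‖ ^ 2) := by
  have h1 : Torus.convect u v x = ∑ i, (u x) i • Torus.partialDeriv i v x :=
    Torus.fderiv_apply_eq_sum_partialDeriv (hv.isContDiff (by simp)) x (u x)
  rw [h1]
  calc ‖∑ i, (u x) i • Torus.partialDeriv i v x‖
      ≤ ∑ i, ‖(u x) i • Torus.partialDeriv i v x‖ := norm_sum_le _ _
    _ = ∑ i, |(u x) i| * ‖Torus.partialDeriv i v x‖ := by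
        refine Finset.sum_congr rfl fun i _ => ?_
        rw [norm_smul, Real.norm_eq_abs]
    _ ≤ Real.sqrt (∑ i, |(u x) i| ^ 2) * Real.sqrt (∑ i, ‖Torus.partialDeriv i v x‖ ^ 2) :=
        Real.sum_mul_le_sqrt_mul_sqrt _ _ _
    _ = ‖u x‖ * Real.sqrt (∑ i, ‖Torus.partialDeriv i v x‖ ^ 2) := by
        rw [EuclideanSpace.norm_eq]
        simp only [Real.norm_eq_abs]

/-- `∫ ⟪(u·∇)u, Δu⟫ ≤ M (‖∇u‖₂²)^{1/2} (‖Δu‖₂²)^{1/2}` when `‖u(x)‖ ≤ M` everywhere (file-private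
twin of the helper in `ExtremeGrowthBoundsProofs.lean`). [cite: Ayala2014Thesis, App. A, proof of (A.7)] -/
private theorem integral_inner_convect_laplacian_le_aux {u : UnitAddTorus d → EuclideanSpace ℝ d}
    (hu : Torus.IsSmooth u) {M : ℝ} (hM0 : 0 ≤ M) (hM : ∀ x, ‖u x‖ ≤ M) :
    ∫ x, ⟪Torus.convect u u x, Torus.laplacian u x⟫_ℝ ≤
      M * Real.sqrt (Torus.gradNormSq u) * Real.sqrt (∫ x, ‖Torus.laplacian u x‖ ^ 2) := by
  set g : UnitAddTorus d → ℝ := fun x => Real.sqrt (∑ i, ‖Torus.partialDeriv i u x‖ ^ 2) with hg_def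
  set h : UnitAddTorus d → ℝ := fun x => ‖Torus.laplacian u x‖ with hh_def
  have hθs : Torus.IsSmooth (fun x => ∑ i, ‖Torus.partialDeriv i u x‖ ^ 2) :=
    Torus.isSmooth_sum_norm_sq_partialDeriv hu
  have hgc : Continuous g := hθs.continuous.sqrt
  have hhc : Continuous h := hu.laplacian.continuous.norm
  have hg0 : ∀ x, 0 ≤ g x := fun x => Real.sqrt_nonneg _
  have hh0 : ∀ x, 0 ≤ h x := fun x => norm_nonneg _
  have hpt : ∀ x, ⟪Torus.convect u u x, Torus.laplacian u x⟫_ℝ ≤ M * (g x * h x) := by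
    intro x
    calc ⟪Torus.convect u u x, Torus.laplacian u x⟫_ℝ
        ≤ ‖Torus.convect u u x‖ * ‖Torus.laplacian u x‖ := real_inner_le_norm _ _
      _ ≤ (‖u x‖ * g x) * h x :=
          mul_le_mul_of_nonneg_right (norm_convect_le_norm_mul_sqrt_aux hu x) (norm_nonneg _)
      _ ≤ (M * g x) * h x :=
          mul_le_mul_of_nonneg_right (mul_le_mul_of_nonneg_right (hM x) (hg0 x)) (hh0 x)
      _ = M * (g x * h x) := by ring
  have hgm : MemLp g (ENNReal.ofReal 2) volume :=
    hgc.memLp_of_hasCompactSupport (HasCompactSupport.of_compactSpace g)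
  have hhm : MemLp h (ENNReal.ofReal 2) volume :=
    hhc.memLp_of_hasCompactSupport (HasCompactSupport.of_compactSpace h)
  have hcs := integral_mul_le_Lp_mul_Lq_of_nonneg (μ := volume) Real.HolderConjugate.two_two
    (ae_of_all _ hg0) (ae_of_all _ hh0) hgm hhm
  have e1 : ∫ x, g x ^ (2 : ℝ) = Torus.gradNormSq u := by
    rw [Torus.gradNormSq]
    exact integral_congr_ae (ae_of_all _ fun x => by
      dsimp only
      rw [Real.rpow_two, hg_def, Real.sq_sqrt (Finset.sum_nonneg fun i _ => sq_nonneg _)])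
  have e2 : ∫ x, h x ^ (2 : ℝ) = ∫ x, ‖Torus.laplacian u x‖ ^ 2 :=
    integral_congr_ae (ae_of_all _ fun x => by dsimp only; rw [Real.rpow_two])
  rw [e1, e2, ← Real.sqrt_eq_rpow, ← Real.sqrt_eq_rpow] at hcs
  have hint1 : Integrable (fun x => ⟪Torus.convect u u x, Torus.laplacian u x⟫_ℝ) volume :=
    ((hu.convect hu).continuous.inner hu.laplacian.continuous).integrable_unitAddTorus
  have hint2 : Integrable (fun x => M * (g x * h x)) volume :=
    ((hgc.mul hhc).integrable_unitAddTorus).const_mul M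
  calc ∫ x, ⟪Torus.convect u u x, Torus.laplacian u x⟫_ℝ
      ≤ ∫ x, M * (g x * h x) := integral_mono hint1 hint2 hpt
    _ = M * ∫ x, g x * h x := integral_const_mul _ _
    _ ≤ M * (Real.sqrt (Torus.gradNormSq u) * Real.sqrt (∫ x, ‖Torus.laplacian u x‖ ^ 2)) :=
        mul_le_mul_of_nonneg_left hcs hM0
    _ = M * Real.sqrt (Torus.gradNormSq u) * Real.sqrt (∫ x, ‖Torus.laplacian u x‖ ^ 2) := by
        ring

omit [Fintype d] [DecidableEq d] in
/-- Young with HALF the dissipation: for `ν > 0`, `a, y, M ≥ 0` with `M⁴ ≤ (4/π⁴) a² y²`,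
`M a y − (ν/2) y² ≤ 27 a⁶/(8 π⁴ ν³)` (polynomial AM–GM, as in the Lu–Doering discharge with `ν/2`).
[cite: Ayala2014Thesis, App. A (A.8)] -/
private theorem young_quartic_half_le {ν a y M : ℝ} (hν : 0 < ν) (ha : 0 ≤ a) (hy : 0 ≤ y)
    (hM : 0 ≤ M) (hAg : M ^ 4 ≤ 4 / π ^ 4 * a ^ 2 * y ^ 2) :
    M * a * y - ν / 2 * y ^ 2 ≤ 27 * a ^ 6 / (8 * π ^ 4 * ν ^ 3) := by
  have hπ : 0 < π := Real.pi_pos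
  set c : ℝ := 27 * a ^ 6 / (8 * π ^ 4 * ν ^ 3) with hc
  have hc0 : 0 ≤ c := by positivity
  set p : ℝ := ν * y ^ 2 / 6 with hp
  have hp0 : 0 ≤ p := by positivity
  have hamgm : 256 * p ^ 3 * c ≤ (3 * p + c) ^ 4 := by
    have hid : (3 * p + c) ^ 4 - 256 * p ^ 3 * c =
        (p - c) ^ 2 * (81 * p ^ 2 + 14 * p * c + c ^ 2) := by ring
    have hnn : 0 ≤ (p - c) ^ 2 * (81 * p ^ 2 + 14 * p * c + c ^ 2) := by positivity
    linarith
  have hP4 : (M * a * y) ^ 4 ≤ 256 * p ^ 3 * c := by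
    have e : 256 * p ^ 3 * c = 4 / π ^ 4 * a ^ 2 * y ^ 2 * (a ^ 4 * y ^ 4) := by
      rw [hp, hc]; field_simp; ring
    rw [e, show (M * a * y) ^ 4 = M ^ 4 * (a ^ 4 * y ^ 4) by ring]
    exact mul_le_mul_of_nonneg_right hAg (by positivity)
  have h3p : 3 * p + c = ν / 2 * y ^ 2 + c := by rw [hp]; ring
  have hle4 : (M * a * y) ^ 4 ≤ (ν / 2 * y ^ 2 + c) ^ 4 := by rw [← h3p]; exact hP4.trans hamgm
  have hMay : 0 ≤ M * a * y := by positivity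
  have hrhs : 0 ≤ ν / 2 * y ^ 2 + c := by positivity
  have hle : M * a * y ≤ ν / 2 * y ^ 2 + c := (pow_le_pow_iff_left₀ hMay hrhs (by norm_num)).1 hle4
  linarith

omit [Fintype d] [DecidableEq d] in
/-- AM–GM for `(Q, m, m, m)`: `256 Q m³ ≤ (Q + 3m)⁴` (`Q, m ≥ 0`). [cite: Ayala2014Thesis, App. A (A.8)] -/
private theorem amgm_quartic_aux {Q m : ℝ} (hQ : 0 ≤ Q) (hm : 0 ≤ m) :
    256 * Q * m ^ 3 ≤ (Q + 3 * m) ^ 4 := by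
  have hid : (Q + 3 * m) ^ 4 - 256 * Q * m ^ 3 =
      (m - Q) ^ 2 * (81 * m ^ 2 + 14 * m * Q + Q ^ 2) := by ring
  have hnn : 0 ≤ (m - Q) ^ 2 * (81 * m ^ 2 + 14 * m * Q + Q ^ 2) := by positivity
  linarith

end Helpers

/-! ## The slice-level objects: rate of `‖∇u‖₂²`, the potential `Ψ`, the sup-bound coefficients -/

section Slice

/-- The constant `27/(4π⁴ν³)` of the `H¹` balance with half dissipation kept,
`d/dt‖∇u‖₂² ≤ −ν‖Δu‖₂² + (27/(4π⁴ν³))‖∇u‖₂⁶` (twice the Lu–Doering form with `ν/2`).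
[cite: Ayala2014Thesis, App. A (A.7)–(A.8)] -/
def fgtRateConst (ν : ℝ) : ℝ := 27 / (4 * π ^ 4 * ν ^ 3)

/-- The rate of `‖∇v‖₂²` dictated by the unforced momentum equation at a slice `v`:
`2(−ν‖Δv‖₂² + ∫⟪(v·∇)v, Δv⟫)` (twice the `H¹` balance rate
`Torus.IsClassicalNSSolutionOn.hasDerivWithinAt_half_gradNormSq` with `f = 0`).
[cite: RobinsonRodrigoSadowskiCUP2016, Lemma 8.15 (proof, (6.7))] -/
def gradNormSqRate (ν : ℝ) (v : UnitAddTorus d → EuclideanSpace ℝ d) : ℝ :=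
  2 * (-ν * (∫ x, ‖Torus.laplacian v x‖ ^ 2) + ∫ x, ⟪Torus.convect v v x, Torus.laplacian v x⟫_ℝ)

/-- The Foias–Guillopé–Temam potential in smooth-window form, `Ψ(v) = (1 + ‖∇v‖₂²)⁻¹ ∈ (0, 1]`
(RRS16 use `−‖∇u‖₂⁻²`; the shift by `1` avoids dividing by a vanishing enstrophy).
[cite: RobinsonRodrigoSadowskiCUP2016, Lemma 8.15 (proof)] -/
def fgtPotential (v : UnitAddTorus d → EuclideanSpace ℝ d) : ℝ := (1 + Torus.gradNormSq v)⁻¹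

/-- The rate of the potential along the flow, `Ψ' = −(d/dt‖∇u‖₂²)/(1 + ‖∇u‖₂²)²`, at a slice.
[cite: RobinsonRodrigoSadowskiCUP2016, Lemma 8.15 (proof)] -/
def fgtPotentialRate (ν : ℝ) (v : UnitAddTorus d → EuclideanSpace ℝ d) : ℝ :=
  -gradNormSqRate ν v / (1 + Torus.gradNormSq v) ^ 2

omit [Fintype d] [DecidableEq d] in
/-- `α_ν = √2/(4πν)`, the coefficient of `Ψ'` in the pointwise sup bound.
[cite: RobinsonRodrigoSadowskiCUP2016, Lemma 8.15, (8.7)] -/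
def fgtRateCoeff (ν : ℝ) : ℝ := Real.sqrt 2 / (4 * π * ν)

omit [Fintype d] [DecidableEq d] in
/-- `β = 3√2/(4π)`, the constant term of the pointwise sup bound.
[cite: RobinsonRodrigoSadowskiCUP2016, Lemma 8.15, (8.7)] -/
def fgtConstCoeff : ℝ := 3 * Real.sqrt 2 / (4 * π)

omit [Fintype d] [DecidableEq d] in
/-- `γ_ν = √2·(27/(4π⁴ν³))/(4πν) + 3√2/(4π)`, the coefficient of `‖∇u‖₂²` in the pointwise sup
bound. [cite: RobinsonRodrigoSadowskiCUP2016, Lemma 8.15, (8.7)] -/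
def fgtGradCoeff (ν : ℝ) : ℝ := Real.sqrt 2 * fgtRateConst ν / (4 * π * ν) + 3 * Real.sqrt 2 / (4 * π)

/-- The pointwise sup-norm majorant `α_ν Ψ'(v) + β + γ_ν ‖∇v‖₂²`.
[cite: RobinsonRodrigoSadowskiCUP2016, Lemma 8.15, (8.7)] -/
def fgtSupBound (ν : ℝ) (v : UnitAddTorus d → EuclideanSpace ℝ d) : ℝ :=
  fgtRateCoeff ν * fgtPotentialRate ν v + fgtConstCoeff + fgtGradCoeff ν * Torus.gradNormSq v

omit [Fintype d] [DecidableEq d] in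
/-- `0 ≤ 27/(4π⁴ν³)` for `ν > 0`. [cite: Ayala2014Thesis, App. A (A.8)] -/
theorem fgtRateConst_nonneg {ν : ℝ} (hν : 0 < ν) : 0 ≤ fgtRateConst ν := by
  unfold fgtRateConst; positivity

omit [Fintype d] [DecidableEq d] in
/-- `0 ≤ α_ν`. [cite: RobinsonRodrigoSadowskiCUP2016, Lemma 8.15, (8.7)] -/
theorem fgtRateCoeff_nonneg {ν : ℝ} (hν : 0 < ν) : 0 ≤ fgtRateCoeff ν := by
  unfold fgtRateCoeff; positivity

omit [Fintype d] [DecidableEq d] in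
/-- `0 ≤ β`. [cite: RobinsonRodrigoSadowskiCUP2016, Lemma 8.15, (8.7)] -/
theorem fgtConstCoeff_nonneg : 0 ≤ fgtConstCoeff := by
  unfold fgtConstCoeff; positivity

omit [Fintype d] [DecidableEq d] in
/-- `0 ≤ γ_ν`. [cite: RobinsonRodrigoSadowskiCUP2016, Lemma 8.15, (8.7)] -/
theorem fgtGradCoeff_nonneg {ν : ℝ} (hν : 0 < ν) : 0 ≤ fgtGradCoeff ν := by
  unfold fgtGradCoeff fgtRateConst; positivity

/-- `0 < Ψ(v)`. [cite: RobinsonRodrigoSadowskiCUP2016, Lemma 8.15 (proof)] -/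
theorem fgtPotential_pos (v : UnitAddTorus d → EuclideanSpace ℝ d) : 0 < fgtPotential v := by
  unfold fgtPotential
  have := Torus.gradNormSq_nonneg v
  positivity

/-- `Ψ(v) ≤ 1`. [cite: RobinsonRodrigoSadowskiCUP2016, Lemma 8.15 (proof)] -/
theorem fgtPotential_le_one (v : UnitAddTorus d → EuclideanSpace ℝ d) : fgtPotential v ≤ 1 := by
  unfold fgtPotential
  have := Torus.gradNormSq_nonneg v
  exact inv_le_one_of_one_le₀ (by linarith)

/-- `Ψ'(1 + ‖∇v‖₂²)² = −(d/dt)‖∇v‖₂²`. [cite: RobinsonRodrigoSadowskiCUP2016, Lemma 8.15 (proof)] -/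
theorem fgtPotentialRate_mul_sq (ν : ℝ) (v : UnitAddTorus d → EuclideanSpace ℝ d) :
    fgtPotentialRate ν v * (1 + Torus.gradNormSq v) ^ 2 = -gradNormSqRate ν v := by
  unfold fgtPotentialRate
  have hne : (1 + Torus.gradNormSq v) ^ 2 ≠ 0 := by
    have := Torus.gradNormSq_nonneg v
    positivity
  exact div_mul_cancel₀ _ hne

/-- **The `H¹` balance with half dissipation kept** on `T³`: for a smooth mean-zero `v`,
`gradNormSqRate ν v ≤ −ν‖Δv‖₂² + (27/(4π⁴ν³))‖∇v‖₂⁶` (Cauchy–Schwarz for the trilinear term,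
Agmon `‖v‖_∞⁴ ≤ (4/π⁴)‖∇v‖₂²‖Δv‖₂²`, Young against `(ν/2)‖Δv‖₂²`).
[cite: RobinsonRodrigoSadowskiCUP2016, Lemma 8.15 (proof: d/dt‖∇u‖² + ‖Au‖² ≤ c‖∇u‖⁶)]
[cite: Ayala2014Thesis, App. A (A.7)–(A.8)] -/
theorem gradNormSqRate_le (hd : Fintype.card d = 3) {ν : ℝ} (hν : 0 < ν)
    {v : UnitAddTorus d → EuclideanSpace ℝ d} (hv : Torus.IsSmooth v) (h0 : Torus.HasZeroMean v) :
    gradNormSqRate ν v ≤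
      -ν * (∫ x, ‖Torus.laplacian v x‖ ^ 2) + fgtRateConst ν * Torus.gradNormSq v ^ 3 := by
  have hπ : 0 < π := Real.pi_pos
  obtain ⟨A2, hA2⟩ : ∃ A2 : ℝ, A2 = Torus.gradNormSq v := ⟨_, rfl⟩
  obtain ⟨B2, hB2⟩ : ∃ B2 : ℝ, B2 = ∫ x, ‖Torus.laplacian v x‖ ^ 2 := ⟨_, rfl⟩
  have hA0 : 0 ≤ A2 := by rw [hA2]; exact Torus.gradNormSq_nonneg v
  have hB0 : 0 ≤ B2 := by rw [hB2]; positivity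
  set aa : ℝ := Real.sqrt A2 with haa
  set yy : ℝ := Real.sqrt B2 with hyy
  have haa0 : 0 ≤ aa := Real.sqrt_nonneg _
  have hyy0 : 0 ≤ yy := Real.sqrt_nonneg _
  set m4 : ℝ := 4 / π ^ 4 * A2 * B2 with hm4
  have hm40 : 0 ≤ m4 := by positivity
  set M : ℝ := Real.sqrt (Real.sqrt m4) with hMdef
  have hM0 : 0 ≤ M := Real.sqrt_nonneg _
  have hM4 : M ^ 4 = m4 := by
    rw [show (4 : ℕ) = 2 * 2 by norm_num, pow_mul, hMdef, Real.sq_sqrt (Real.sqrt_nonneg _),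
      Real.sq_sqrt hm40]
  have hMx : ∀ x, ‖v x‖ ≤ M := by
    intro x
    have h4 := Torus.norm_pow_four_le_agmon_explicit hd hv h0 x
    rw [← hA2, ← hB2] at h4
    have h4' : ‖v x‖ ^ 4 ≤ M ^ 4 := by rw [hM4, hm4]; exact h4
    exact (pow_le_pow_iff_left₀ (norm_nonneg _) hM0 (by norm_num)).1 h4'
  have hAg : M ^ 4 ≤ 4 / π ^ 4 * aa ^ 2 * yy ^ 2 := by
    rw [hM4, hm4, haa, hyy, Real.sq_sqrt hA0, Real.sq_sqrt hB0]
  have hCS : ∫ x, ⟪Torus.convect v v x, Torus.laplacian v x⟫_ℝ ≤ M * aa * yy := by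
    have h := integral_inner_convect_laplacian_le_aux hv hM0 hMx
    rw [← hA2, ← hB2] at h
    exact h
  have hyoung := young_quartic_half_le hν haa0 hyy0 hM0 hAg
  have hB2' : yy ^ 2 = B2 := by rw [hyy, Real.sq_sqrt hB0]
  have ha6 : aa ^ 6 = A2 ^ 3 := by
    rw [show (6 : ℕ) = 2 * 3 by norm_num, pow_mul, haa, Real.sq_sqrt hA0]
  have hc : 27 * aa ^ 6 / (8 * π ^ 4 * ν ^ 3) = fgtRateConst ν * A2 ^ 3 / 2 := by
    rw [ha6, fgtRateConst]
    field_simp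
    ring
  rw [hB2', hc] at hyoung
  unfold gradNormSqRate
  rw [← hA2, ← hB2]
  nlinarith [hCS, hyoung]

/-- **`ν‖Δv‖₂² ≤ (Ψ' + (27/(4π⁴ν³))‖∇v‖₂²)(1 + ‖∇v‖₂²)²`**: the dissipation is dominated by
the rate of the bounded potential plus an energy-integrable term (RRS16: divide the `H¹` balance
by `‖∇u‖⁴`). [cite: RobinsonRodrigoSadowskiCUP2016, Lemma 8.15 (proof)] -/
theorem nu_mul_integral_norm_laplacian_sq_le (hd : Fintype.card d = 3) {ν : ℝ} (hν : 0 < ν)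
    {v : UnitAddTorus d → EuclideanSpace ℝ d} (hv : Torus.IsSmooth v) (h0 : Torus.HasZeroMean v) :
    ν * (∫ x, ‖Torus.laplacian v x‖ ^ 2) ≤
      (fgtPotentialRate ν v + fgtRateConst ν * Torus.gradNormSq v) *
        (1 + Torus.gradNormSq v) ^ 2 := by
  have h1 := gradNormSqRate_le hd hν hv h0
  have h2 := fgtPotentialRate_mul_sq ν v
  have hG := Torus.gradNormSq_nonneg v
  have hc := fgtRateConst_nonneg hν
  have h3 : fgtRateConst ν * Torus.gradNormSq v ^ 3 ≤
      fgtRateConst ν * Torus.gradNormSq v * (1 + Torus.gradNormSq v) ^ 2 := by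
    have : Torus.gradNormSq v ^ 3 ≤ Torus.gradNormSq v * (1 + Torus.gradNormSq v) ^ 2 := by
      nlinarith [sq_nonneg (Torus.gradNormSq v)]
    rw [mul_assoc]
    exact mul_le_mul_of_nonneg_left this hc
  have h4 : (fgtPotentialRate ν v + fgtRateConst ν * Torus.gradNormSq v) *
      (1 + Torus.gradNormSq v) ^ 2 =
      fgtPotentialRate ν v * (1 + Torus.gradNormSq v) ^ 2 +
        fgtRateConst ν * Torus.gradNormSq v * (1 + Torus.gradNormSq v) ^ 2 := by ring
  linarith [h1, h2, h3, h4]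

/-- The sum `Ψ' + (27/(4π⁴ν³))‖∇v‖₂²` is nonnegative. [cite: RobinsonRodrigoSadowskiCUP2016, Lemma 8.15 (proof)] -/
theorem fgtPotentialRate_add_nonneg (hd : Fintype.card d = 3) {ν : ℝ} (hν : 0 < ν)
    {v : UnitAddTorus d → EuclideanSpace ℝ d} (hv : Torus.IsSmooth v) (h0 : Torus.HasZeroMean v) :
    0 ≤ fgtPotentialRate ν v + fgtRateConst ν * Torus.gradNormSq v := by
  have hkey := nu_mul_integral_norm_laplacian_sq_le hd hν hv h0
  have hD : 0 ≤ ν * (∫ x, ‖Torus.laplacian v x‖ ^ 2) :=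
    mul_nonneg hν.le (integral_nonneg fun x => by positivity)
  have hm : 0 < (1 + Torus.gradNormSq v) ^ 2 := by
    have := Torus.gradNormSq_nonneg v
    positivity
  by_contra hneg
  have := mul_neg_of_neg_of_pos (not_le.1 hneg) hm
  linarith

/-- **The pointwise Foias–Guillopé–Temam sup bound** on `T³`: for a smooth mean-zero `v` and
`ν > 0`, every `x` has `‖v(x)‖ ≤ α_ν Ψ'(v) + β + γ_ν ‖∇v‖₂²` (`fgtSupBound`): Agmon
`‖v‖_∞⁴ ≤ (4/π⁴)‖∇v‖₂²‖Δv‖₂²`, the previous lemma, and AM–GM with weights `1/4, 3/4`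
(RRS16: `‖u‖_∞ ≤ c‖∇u‖^{1/2}‖Au‖^{1/2} ≤ c‖∇u‖² + c‖Au‖^{2/3}`).
[cite: RobinsonRodrigoSadowskiCUP2016, Lemma 8.15, (8.7)] [cite: FoiasGuillopeTemam1981, main a priori estimate] -/
theorem norm_le_fgtSupBound (hd : Fintype.card d = 3) {ν : ℝ} (hν : 0 < ν)
    {v : UnitAddTorus d → EuclideanSpace ℝ d} (hv : Torus.IsSmooth v) (h0 : Torus.HasZeroMean v)
    (x : UnitAddTorus d) : ‖v x‖ ≤ fgtSupBound ν v := by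
  have hπ : 0 < π := Real.pi_pos
  have hkey := nu_mul_integral_norm_laplacian_sq_le hd hν hv h0
  have hS0 := fgtPotentialRate_add_nonneg hd hν hv h0
  have hAg := Torus.norm_pow_four_le_agmon_explicit hd hv h0 x
  obtain ⟨G, hG⟩ : ∃ G : ℝ, G = Torus.gradNormSq v := ⟨_, rfl⟩
  obtain ⟨D, hD⟩ : ∃ D : ℝ, D = ∫ y, ‖Torus.laplacian v y‖ ^ 2 := ⟨_, rfl⟩
  obtain ⟨R, hR⟩ : ∃ R : ℝ, R = fgtPotentialRate ν v := ⟨_, rfl⟩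
  obtain ⟨c, hc⟩ : ∃ c : ℝ, c = fgtRateConst ν := ⟨_, rfl⟩
  rw [← hG, ← hD, ← hR, ← hc] at hkey
  rw [← hG, ← hR, ← hc] at hS0
  rw [← hG, ← hD] at hAg
  have hG0 : 0 ≤ G := by rw [hG]; exact Torus.gradNormSq_nonneg v
  have hD0 : 0 ≤ D := by rw [hD]; exact integral_nonneg fun y => by positivity
  set m : ℝ := 1 + G with hm
  have hm0 : 0 < m := by rw [hm]; linarith
  set Q : ℝ := (R + c * G) / ν with hQ
  have hQ0 : 0 ≤ Q := div_nonneg hS0 hν.le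
  -- `G D ≤ Q m³`
  have hGD : G * D ≤ Q * m ^ 3 := by
    have h1 : G * D ≤ m * D := mul_le_mul_of_nonneg_right (by rw [hm]; linarith) hD0
    have h2 : m * D * ν ≤ (R + c * G) * m ^ 3 := by
      calc m * D * ν = (ν * D) * m := by ring
        _ ≤ ((R + c * G) * m ^ 2) * m := mul_le_mul_of_nonneg_right hkey hm0.le
        _ = (R + c * G) * m ^ 3 := by ring
    have h3 : m * D ≤ Q * m ^ 3 := by
      rw [hQ, div_mul_eq_mul_div, le_div_iff₀ hν]
      exact h2
    exact h1.trans h3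
  -- `‖v x‖⁴ ≤ s⁴`, `s = (√2/(4π)) (Q + 3m)`
  set s : ℝ := Real.sqrt 2 / (4 * π) * (Q + 3 * m) with hs
  have hs0 : 0 ≤ s := by positivity
  have hsqrt4 : Real.sqrt 2 ^ 4 = 4 := by
    rw [show (4 : ℕ) = 2 * 2 by norm_num, pow_mul, Real.sq_sqrt (by norm_num : (0 : ℝ) ≤ 2)]
    norm_num
  have hs4 : s ^ 4 = 4 / π ^ 4 * ((Q + 3 * m) ^ 4 / 256) := by
    rw [hs, mul_pow, div_pow, hsqrt4]
    field_simp
    ring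
  have ham := amgm_quartic_aux hQ0 hm0.le
  have hX4 : ‖v x‖ ^ 4 ≤ s ^ 4 := by
    calc ‖v x‖ ^ 4 ≤ 4 / π ^ 4 * G * D := hAg
      _ = 4 / π ^ 4 * (G * D) := by ring
      _ ≤ 4 / π ^ 4 * (Q * m ^ 3) := mul_le_mul_of_nonneg_left hGD (by positivity)
      _ ≤ 4 / π ^ 4 * ((Q + 3 * m) ^ 4 / 256) := by
          refine mul_le_mul_of_nonneg_left ?_ (by positivity)
          rw [le_div_iff₀ (by norm_num : (0 : ℝ) < 256)]
          linarith [ham]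
      _ = s ^ 4 := hs4.symm
  have hXs : ‖v x‖ ≤ s := (pow_le_pow_iff_left₀ (norm_nonneg _) hs0 (by norm_num)).1 hX4
  have hsE : s = fgtSupBound ν v := by
    unfold fgtSupBound fgtRateCoeff fgtConstCoeff fgtGradCoeff
    rw [← hG, ← hR, ← hc, hs, hQ, hm]
    field_simp
    ring
  exact hXs.trans hsE.le

omit [DecidableEq d] in
/-- The sup of `‖v‖` over the compact torus is attained (file-private helper). [folklore] -/
private theorem exists_forall_norm_le_norm {v : UnitAddTorus d → EuclideanSpace ℝ d} (hv : Continuous v) :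
    ∃ x₀, ∀ x, ‖v x‖ ≤ ‖v x₀‖ := by
  obtain ⟨x₀, -, hx₀⟩ :=
    isCompact_univ.exists_isMaxOn univ_nonempty (hv.norm.continuousOn (s := univ))
  exact ⟨x₀, fun x => (isMaxOn_iff.1 hx₀) x (mem_univ x)⟩

omit [DecidableEq d] in
/-- `∫‖v‖^q ≤ U^{q−6} ∫‖v‖⁶` when `‖v‖ ≤ U` pointwise and `q > 6`.
[cite: RobinsonRodrigoSadowskiCUP2016, Lemma 8.15, (8.7) (use: interpolation L⁶–L^∞)] -/
theorem integral_norm_rpow_le_rpow_mul_integral_norm_pow_six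
    {v : UnitAddTorus d → EuclideanSpace ℝ d} (hv : Continuous v) {U q : ℝ} (hq : 6 < q)
    (hU : ∀ x, ‖v x‖ ≤ U) :
    ∫ x, ‖v x‖ ^ q ≤ U ^ (q - 6) * ∫ x, ‖v x‖ ^ 6 := by
  have hpt : ∀ x, ‖v x‖ ^ q ≤ U ^ (q - 6) * ‖v x‖ ^ 6 := by
    intro x
    have hn := norm_nonneg (v x)
    have e : ‖v x‖ ^ q = ‖v x‖ ^ (q - 6) * ‖v x‖ ^ 6 := by
      rw [← Real.rpow_natCast ‖v x‖ 6,
        ← Real.rpow_add' hn (ne_of_gt (by push_cast; linarith))]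
      congr 1
      push_cast
      ring
    rw [e]
    exact mul_le_mul_of_nonneg_right (Real.rpow_le_rpow hn (hU x) (by linarith)) (by positivity)
  have hi1 : Integrable (fun x => ‖v x‖ ^ q) volume :=
    (hv.norm.rpow_const fun x => Or.inr (by linarith)).integrable_unitAddTorus
  have hi2 : Integrable (fun x => U ^ (q - 6) * ‖v x‖ ^ 6) volume :=
    ((hv.norm.pow 6).integrable_unitAddTorus).const_mul _
  calc ∫ x, ‖v x‖ ^ q ≤ ∫ x, U ^ (q - 6) * ‖v x‖ ^ 6 := integral_mono hi1 hi2 hpt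
    _ = U ^ (q - 6) * ∫ x, ‖v x‖ ^ 6 := integral_const_mul _ _

omit [DecidableEq d] in
/-- **`‖v‖_q^{q/(q−3)} ≤ ‖v‖_∞ + ‖v‖₆²` for `q > 6`** (pointwise-in-time form of the Hölder
step `L¹L^∞ ∩ L²L⁶ ⇒ ∫‖u‖_q^{q/(q−3)} < ∞`): if `‖v‖ ≤ U` pointwise, `U ≥ 0`, then
`(∫‖v‖^q)^{1/(q−3)} ≤ U + (∫‖v‖⁶)^{1/3}` (weighted AM–GM, weights `(q−6)/(q−3)`, `3/(q−3)`).
[cite: Protas2026, §4.1, eq. (50), p. 65 (q > 6)] -/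
theorem rpow_integral_norm_rpow_le_add {v : UnitAddTorus d → EuclideanSpace ℝ d}
    (hv : Continuous v) {U q : ℝ} (hq : 6 < q) (hU0 : 0 ≤ U) (hU : ∀ x, ‖v x‖ ≤ U) :
    (∫ x, ‖v x‖ ^ q) ^ (1 / (q - 3)) ≤ U + (∫ x, ‖v x‖ ^ 6) ^ (1 / 3 : ℝ) := by
  have hq3 : 0 < q - 3 := by linarith
  have hq3' : q - 3 ≠ 0 := ne_of_gt hq3
  have hq6 : 0 < q - 6 := by linarith
  have hIq : 0 ≤ ∫ x, ‖v x‖ ^ q := integral_nonneg fun x => Real.rpow_nonneg (norm_nonneg _) _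
  have hI6 : 0 ≤ ∫ x, ‖v x‖ ^ 6 := integral_nonneg fun x => by positivity
  have h1 := integral_norm_rpow_le_rpow_mul_integral_norm_pow_six hv hq hU
  have h2 : (∫ x, ‖v x‖ ^ q) ^ (1 / (q - 3)) ≤
      (U ^ (q - 6) * ∫ x, ‖v x‖ ^ 6) ^ (1 / (q - 3)) :=
    Real.rpow_le_rpow hIq h1 (by positivity)
  have h3 : (U ^ (q - 6) * ∫ x, ‖v x‖ ^ 6) ^ (1 / (q - 3)) =
      U ^ ((q - 6) / (q - 3)) * ((∫ x, ‖v x‖ ^ 6) ^ (1 / 3 : ℝ)) ^ (3 / (q - 3)) := by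
    rw [Real.mul_rpow (Real.rpow_nonneg hU0 _) hI6, ← Real.rpow_mul hU0, ← Real.rpow_mul hI6,
      mul_one_div]
    congr 2
    field_simp
  have hw1 : 0 ≤ (q - 6) / (q - 3) := by positivity
  have hw2 : 0 ≤ 3 / (q - 3) := by positivity
  have hw : (q - 6) / (q - 3) + 3 / (q - 3) = 1 := by
    field_simp
    ring
  have h4 := Real.geom_mean_le_arith_mean2_weighted hw1 hw2 hU0 (Real.rpow_nonneg hI6 (1 / 3 : ℝ)) hw
  have h5 : (q - 6) / (q - 3) * U + 3 / (q - 3) * (∫ x, ‖v x‖ ^ 6) ^ (1 / 3 : ℝ) ≤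
      U + (∫ x, ‖v x‖ ^ 6) ^ (1 / 3 : ℝ) := by
    have hw1' : (q - 6) / (q - 3) ≤ 1 := by rw [div_le_one hq3]; linarith
    have hw2' : 3 / (q - 3) ≤ 1 := by rw [div_le_one hq3]; linarith
    have hJ := Real.rpow_nonneg hI6 (1 / 3 : ℝ)
    nlinarith [mul_le_mul_of_nonneg_right hw1' hU0, mul_le_mul_of_nonneg_right hw2' hJ]
  calc (∫ x, ‖v x‖ ^ q) ^ (1 / (q - 3))
      ≤ (U ^ (q - 6) * ∫ x, ‖v x‖ ^ 6) ^ (1 / (q - 3)) := h2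
    _ = U ^ ((q - 6) / (q - 3)) * ((∫ x, ‖v x‖ ^ 6) ^ (1 / 3 : ℝ)) ^ (3 / (q - 3)) := h3
    _ ≤ (q - 6) / (q - 3) * U + 3 / (q - 3) * (∫ x, ‖v x‖ ^ 6) ^ (1 / 3 : ℝ) := h4
    _ ≤ U + (∫ x, ‖v x‖ ^ 6) ^ (1 / 3 : ℝ) := h5

end Slice

/-! ## Along classical solutions: derivatives of `‖∇u‖₂²`, `Ψ`, `K`, and the primitive -/

section Solution

variable {ν a b : ℝ} {u : ℝ → UnitAddTorus d → EuclideanSpace ℝ d} {p : ℝ → UnitAddTorus d → ℝ}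

/-- `d/dt ‖∇u(t)‖₂² = gradNormSqRate ν (u t)` within `[a, b]` along a classical solution of the
unforced system (twice the `H¹` balance). [cite: RobinsonRodrigoSadowskiCUP2016, Lemma 8.15 (proof, (6.7))] -/
theorem hasDerivWithinAt_gradNormSq_of_solution (hab : a < b)
    (h : Torus.IsClassicalNSSolutionOn (Icc a b) ν 0 u p) {t : ℝ} (ht : t ∈ Icc a b) :
    HasDerivWithinAt (fun s => Torus.gradNormSq (u s)) (gradNormSqRate ν (u t)) (Icc a b) t := by
  have hbal := (h.hasDerivWithinAt_half_gradNormSq hab ht).const_mul (2 : ℝ)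
  have e : (fun s => (2 : ℝ) * (2⁻¹ * Torus.gradNormSq (u s))) = fun s => Torus.gradNormSq (u s) := by
    funext s
    ring
  rw [e] at hbal
  refine hbal.congr_deriv ?_
  simp only [gradNormSqRate, Pi.zero_apply, sub_zero]

/-- `dΨ/dt = fgtPotentialRate ν (u t)` within `[a, b]`. [cite: RobinsonRodrigoSadowskiCUP2016, Lemma 8.15 (proof)] -/
theorem hasDerivWithinAt_fgtPotential_of_solution (hab : a < b)
    (h : Torus.IsClassicalNSSolutionOn (Icc a b) ν 0 u p) {t : ℝ} (ht : t ∈ Icc a b) :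
    HasDerivWithinAt (fun s => fgtPotential (u s)) (fgtPotentialRate ν (u t)) (Icc a b) t := by
  have hG := hasDerivWithinAt_gradNormSq_of_solution hab h ht
  have hne : 1 + Torus.gradNormSq (u t) ≠ 0 := by
    have := Torus.gradNormSq_nonneg (u t)
    positivity
  have hinv := (hG.const_add 1).inv hne
  unfold fgtPotential fgtPotentialRate
  refine hinv.congr_deriv ?_
  rw [neg_div]

/-- `dK/dt = −ν‖∇u(t)‖₂²` within `[a, b]` for the unforced system (energy identity).
[cite: Protas2026, §2, eq. (14) and §3.1 (energy equation), p. 18] -/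
theorem hasDerivWithinAt_kineticEnergy_of_solution
    (h : Torus.IsClassicalNSSolutionOn (Icc a b) ν 0 u p) {t : ℝ} (ht : t ∈ Icc a b) :
    HasDerivWithinAt (fun s => Torus.kineticEnergy (u s)) (-ν * Torus.gradNormSq (u t))
      (Icc a b) t := by
  have hE := Torus.IsClassicalNSSolutionOn.energy_balance_holds h (convex_Icc a b) ht
  simpa only [Pi.zero_apply, inner_zero_left, integral_zero, add_zero] using hE

/-- The sup-norm primitive `P(t) = α_ν Ψ(u(t)) + β t − (γ_ν/ν) K(u(t))`, whose derivative along
the flow is the pointwise sup majorant `fgtSupBound` — the `L¹(0,T;L^∞)` bound (8.7) in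
primitive form. [cite: RobinsonRodrigoSadowskiCUP2016, Lemma 8.15, (8.7)] -/
def fgtSupPrimitive (ν : ℝ) (u : ℝ → UnitAddTorus d → EuclideanSpace ℝ d) (t : ℝ) : ℝ :=
  fgtRateCoeff ν * fgtPotential (u t) + fgtConstCoeff * t -
    fgtGradCoeff ν / ν * Torus.kineticEnergy (u t)

/-- `dP/dt = fgtSupBound ν (u t)` within `[a, b]`. [cite: RobinsonRodrigoSadowskiCUP2016, Lemma 8.15, (8.7)] -/
theorem hasDerivWithinAt_fgtSupPrimitive (hν : 0 < ν) (hab : a < b)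
    (h : Torus.IsClassicalNSSolutionOn (Icc a b) ν 0 u p) {t : ℝ} (ht : t ∈ Icc a b) :
    HasDerivWithinAt (fgtSupPrimitive ν u) (fgtSupBound ν (u t)) (Icc a b) t := by
  have hΨ := hasDerivWithinAt_fgtPotential_of_solution hab h ht
  have hK := hasDerivWithinAt_kineticEnergy_of_solution h ht
  have hid : HasDerivWithinAt (fun s : ℝ => s) 1 (Icc a b) t := (hasDerivAt_id' t).hasDerivWithinAt
  have hsum := ((hΨ.const_mul (fgtRateCoeff ν)).add (hid.const_mul fgtConstCoeff)).sub
    (hK.const_mul (fgtGradCoeff ν / ν))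
  unfold fgtSupPrimitive
  refine hsum.congr_deriv ?_
  unfold fgtSupBound
  field_simp
  ring

/-- **The `L¹(0,T;L^∞)` bound in primitive form**: the increment of `P` over `[a, t] ⊆ [a, b]` is
at most `α_ν + β(b − a) + (γ_ν/ν) K(u(a))` (`0 < Ψ ≤ 1`, `K ≥ 0` decreasing is not even needed).
[cite: RobinsonRodrigoSadowskiCUP2016, Lemma 8.15, (8.7)] [cite: FoiasGuillopeTemam1981, main a priori estimate] -/
theorem fgtSupPrimitive_sub_le (hν : 0 < ν) {t : ℝ} (ht : t ∈ Icc a b) :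
    fgtSupPrimitive ν u t - fgtSupPrimitive ν u a ≤
      fgtRateCoeff ν + fgtConstCoeff * (b - a) + fgtGradCoeff ν / ν * Torus.kineticEnergy (u a) := by
  unfold fgtSupPrimitive
  have h1 := fgtPotential_le_one (u t)
  have h2 := (fgtPotential_pos (u a)).le
  have h3 := Torus.kineticEnergy_nonneg (u t)
  have hα := fgtRateCoeff_nonneg hν
  have hβ := fgtConstCoeff_nonneg
  have hγ : 0 ≤ fgtGradCoeff ν / ν := div_nonneg (fgtGradCoeff_nonneg hν) hν.le
  nlinarith [mul_le_mul_of_nonneg_left h1 hα, mul_nonneg hα h2,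
    mul_le_mul_of_nonneg_left ht.2 hβ, mul_nonneg hγ h3]

end Solution

/-! ## Grönwall in product form and the `q = ∞` / `q > 6` edge theorems -/

section Edge

variable {ν a b : ℝ} {u : ℝ → UnitAddTorus d → EuclideanSpace ℝ d} {p : ℝ → UnitAddTorus d → ℝ}

omit [Fintype d] [DecidableEq d] in
/-- **Grönwall, product form, nonnegative data**: if `y' ≤ A y w` within `[a, b]` and `P' = w`,
then `y(t) ≤ y(a) exp(A (P(t) − P(a)))` (`y ≥ 0` not needed: `t ↦ y e^{−A P}` is nonincreasing).
[cite: Protas2026, App. A, eq. (101) (Grönwall's lemma)] -/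
theorem le_mul_exp_sub_of_deriv_le_mul {y y' P w : ℝ → ℝ} {A a b : ℝ}
    (hy : ∀ t ∈ Icc a b, HasDerivWithinAt y (y' t) (Icc a b) t)
    (hP : ∀ t ∈ Icc a b, HasDerivWithinAt P (w t) (Icc a b) t)
    (hrate : ∀ t ∈ Icc a b, y' t ≤ A * y t * w t) {t : ℝ} (ht : t ∈ Icc a b) :
    y t ≤ y a * Real.exp (A * (P t - P a)) := by
  have hab : a ≤ b := ht.1.trans ht.2
  have ha : a ∈ Icc a b := left_mem_Icc.2 hab
  have hF : ∀ s ∈ Icc a b, HasDerivWithinAt (fun r => y r * Real.exp (-(A * P r)))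
      (y' s * Real.exp (-(A * P s)) + y s * (Real.exp (-(A * P s)) * (-(A * w s))))
      (Icc a b) s := by
    intro s hs
    exact (hy s hs).mul (((hP s hs).const_mul A).neg.exp)
  have hanti : AntitoneOn (fun r => y r * Real.exp (-(A * P r))) (Icc a b) := by
    refine antitoneOn_of_hasDerivWithinAt_nonpos (convex_Icc a b)
      (fun s hs => (hF s hs).continuousWithinAt)
      (fun s hs => (hF s (interior_subset hs)).mono interior_subset) fun s hs => ?_
    have hs' : s ∈ Icc a b := interior_subset hs
    have hE := Real.exp_pos (-(A * P s))
    have hr := hrate s hs'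
    have e : y' s * Real.exp (-(A * P s)) + y s * (Real.exp (-(A * P s)) * (-(A * w s))) =
        Real.exp (-(A * P s)) * (y' s - A * y s * w s) := by ring
    rw [e]
    exact mul_nonpos_iff.2 (Or.inl ⟨hE.le, by linarith⟩)
  have hcmp : y t * Real.exp (-(A * P t)) ≤ y a * Real.exp (-(A * P a)) := hanti ha ht ht.1
  have e2 : -(A * P a) + A * P t = A * (P t - P a) := by ring
  calc y t = y t * Real.exp (-(A * P t)) * Real.exp (A * P t) := by
        rw [mul_assoc, ← Real.exp_add, neg_add_cancel, Real.exp_zero, mul_one]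
    _ ≤ y a * Real.exp (-(A * P a)) * Real.exp (A * P t) :=
        mul_le_mul_of_nonneg_right hcmp (Real.exp_pos _).le
    _ = y a * Real.exp (A * (P t - P a)) := by rw [mul_assoc, ← Real.exp_add, e2]

/-- **The `q = ∞` endpoint of the lower edge, primitive form.** Along a classical mean-zero
solution of the unforced Navier–Stokes equations on `T³` (`ν > 0`) on `[a, b]`: if `y ≥ 0` has
one-sided derivatives `y' ≤ A y ‖u(t, x_t)‖` for some point `x_t` at each time (`A ≥ 0`), then
`y(t) ≤ y(a) exp(A (P(t) − P(a)))` with the sup-norm primitive `P = fgtSupPrimitive`.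
[cite: RobinsonRodrigoSadowskiCUP2016, Lemma 8.15, (8.7)] [cite: Protas2026, §4.1, eq. (50), p. 65] -/
theorem le_mul_exp_sub_of_deriv_le_mul_norm (hd : Fintype.card d = 3) (hν : 0 < ν) (hab : a < b)
    (h : Torus.IsClassicalNSSolutionOn (Icc a b) ν 0 u p)
    (hmean : ∀ t ∈ Icc a b, Torus.HasZeroMean (u t)) {y y' : ℝ → ℝ} {A : ℝ} (hA : 0 ≤ A)
    (hy : ∀ t ∈ Icc a b, HasDerivWithinAt y (y' t) (Icc a b) t) (hy0 : ∀ t ∈ Icc a b, 0 ≤ y t)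
    (hrate : ∀ t ∈ Icc a b, ∃ x, y' t ≤ A * y t * ‖u t x‖) {t : ℝ} (ht : t ∈ Icc a b) :
    y t ≤ y a * Real.exp (A * (fgtSupPrimitive ν u t - fgtSupPrimitive ν u a)) := by
  refine le_mul_exp_sub_of_deriv_le_mul hy
    (fun s hs => hasDerivWithinAt_fgtSupPrimitive hν hab h hs) (fun s hs => ?_) ht
  obtain ⟨x, hx⟩ := hrate s hs
  have hsup := norm_le_fgtSupBound hd hν (h.smooth_velocity.isSmooth_slice hs) (hmean s hs) x
  exact hx.trans (mul_le_mul_of_nonneg_left hsup (mul_nonneg hA (hy0 s hs)))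

/-- **The `q = ∞` endpoint, uniform form**: under the same hypotheses,
`y(t) ≤ y(a) exp(A (α_ν + β (b − a) + (γ_ν/ν) K(u(a))))` for all `t ∈ [a, b]` — no blow-up inside
the window, with a bound depending only on `ν`, the window length and the initial energy.
[cite: RobinsonRodrigoSadowskiCUP2016, Lemma 8.15, (8.7)] [cite: Protas2026, §4.1, eq. (50), p. 65] -/
theorem le_mul_exp_of_deriv_le_mul_norm (hd : Fintype.card d = 3) (hν : 0 < ν) (hab : a < b)
    (h : Torus.IsClassicalNSSolutionOn (Icc a b) ν 0 u p)
    (hmean : ∀ t ∈ Icc a b, Torus.HasZeroMean (u t)) {y y' : ℝ → ℝ} {A : ℝ} (hA : 0 ≤ A)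
    (hy : ∀ t ∈ Icc a b, HasDerivWithinAt y (y' t) (Icc a b) t) (hy0 : ∀ t ∈ Icc a b, 0 ≤ y t)
    (hrate : ∀ t ∈ Icc a b, ∃ x, y' t ≤ A * y t * ‖u t x‖) {t : ℝ} (ht : t ∈ Icc a b) :
    y t ≤ y a * Real.exp (A * (fgtRateCoeff ν + fgtConstCoeff * (b - a) +
      fgtGradCoeff ν / ν * Torus.kineticEnergy (u a))) := by
  have h1 := le_mul_exp_sub_of_deriv_le_mul_norm hd hν hab h hmean hA hy hy0 hrate ht
  have h2 := fgtSupPrimitive_sub_le (u := u) (a := a) (b := b) hν ht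
  exact h1.trans (mul_le_mul_of_nonneg_left
    (Real.exp_le_exp.2 (mul_le_mul_of_nonneg_left h2 hA)) (hy0 a (left_mem_Icc.2 hab.le)))

/-- **Literal `q = ∞` edge**: if `y(t) = ‖u(t, x_t)‖` is attained at some point for every `t`
(e.g. `y(t) = max_x ‖u(t,x)‖`) and `y' ≤ A y²` within `[a, b]` (`A ≥ 0`), then
`y(t) ≤ y(a) exp(A (α_ν + β (b − a) + (γ_ν/ν) K(u(a))))`: the rate `‖u‖_∞' ≲ ‖u‖_∞²`, the
`q → ∞` limit of the second line of (50), cannot blow up.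
[cite: Protas2026, §4.1, eq. (50), p. 65 (q > 6)] [cite: RobinsonRodrigoSadowskiCUP2016, Lemma 8.15, (8.7)] -/
theorem le_mul_exp_of_eq_norm_of_rate_le_sq (hd : Fintype.card d = 3) (hν : 0 < ν) (hab : a < b)
    (h : Torus.IsClassicalNSSolutionOn (Icc a b) ν 0 u p)
    (hmean : ∀ t ∈ Icc a b, Torus.HasZeroMean (u t)) {y y' : ℝ → ℝ} {A : ℝ} (hA : 0 ≤ A)
    (hy : ∀ t ∈ Icc a b, HasDerivWithinAt y (y' t) (Icc a b) t)
    (hyx : ∀ t ∈ Icc a b, ∃ x, y t = ‖u t x‖)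
    (hrate : ∀ t ∈ Icc a b, y' t ≤ A * y t ^ 2) {t : ℝ} (ht : t ∈ Icc a b) :
    y t ≤ y a * Real.exp (A * (fgtRateCoeff ν + fgtConstCoeff * (b - a) +
      fgtGradCoeff ν / ν * Torus.kineticEnergy (u a))) := by
  have hy0 : ∀ s ∈ Icc a b, 0 ≤ y s := by
    intro s hs
    obtain ⟨x, hx⟩ := hyx s hs
    rw [hx]
    exact norm_nonneg _
  refine le_mul_exp_of_deriv_le_mul_norm hd hν hab h hmean hA hy hy0 (fun s hs => ?_) ht
  obtain ⟨x, hx⟩ := hyx s hs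
  refine ⟨x, ?_⟩
  calc y' s ≤ A * y s ^ 2 := hrate s hs
    _ = A * y s * ‖u s x‖ := by rw [← hx]; ring

/-- The `L^q` primitive for `q > 6`: `P_q(t) = P(t) − (c/(2ν)) K(u(t))`, `c = lSixEnstrophyConst`
(its derivative dominates `‖u‖_∞ + ‖u‖₆² ≥ ‖u‖_q^{q/(q−3)}`).
[cite: Protas2026, §4.1, eq. (50), p. 65 (q > 6)] -/
def fgtLqPrimitive (hd : Fintype.card d = 3) (ν : ℝ) (u : ℝ → UnitAddTorus d → EuclideanSpace ℝ d)
    (t : ℝ) : ℝ :=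
  fgtSupPrimitive ν u t - lSixEnstrophyConst hd / (2 * ν) * Torus.kineticEnergy (u t)

/-- `dP_q/dt = fgtSupBound + c ℰ(u(t))` within `[a, b]`. [cite: Protas2026, §4.1, eq. (50), p. 65 (q > 6)] -/
theorem hasDerivWithinAt_fgtLqPrimitive (hd : Fintype.card d = 3) (hν : 0 < ν) (hab : a < b)
    (h : Torus.IsClassicalNSSolutionOn (Icc a b) ν 0 u p) {t : ℝ} (ht : t ∈ Icc a b) :
    HasDerivWithinAt (fgtLqPrimitive hd ν u)
      (fgtSupBound ν (u t) + lSixEnstrophyConst hd * torusEnstrophy (u t)) (Icc a b) t := by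
  have h1 := hasDerivWithinAt_fgtSupPrimitive hν hab h ht
  have h2 := hasDerivWithinAt_kineticEnergy_of_solution h ht
  unfold fgtLqPrimitive
  refine (h1.sub (h2.const_mul (lSixEnstrophyConst hd / (2 * ν)))).congr_deriv ?_
  rw [gradNormSq_eq_two_mul_torusEnstrophy]
  field_simp
  ring

/-- The increment of `P_q` over `[a, t] ⊆ [a, b]` is at most
`α_ν + β(b − a) + (γ_ν/ν + c/(2ν)) K(u(a))`. [cite: Protas2026, §4.1, eq. (50), p. 65 (q > 6)] -/
theorem fgtLqPrimitive_sub_le (hd : Fintype.card d = 3) (hν : 0 < ν) {t : ℝ} (ht : t ∈ Icc a b) :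
    fgtLqPrimitive hd ν u t - fgtLqPrimitive hd ν u a ≤
      fgtRateCoeff ν + fgtConstCoeff * (b - a) +
        (fgtGradCoeff ν / ν + lSixEnstrophyConst hd / (2 * ν)) * Torus.kineticEnergy (u a) := by
  have h1 := fgtSupPrimitive_sub_le (u := u) (a := a) (b := b) hν ht
  have h3 := Torus.kineticEnergy_nonneg (u t)
  have hc : 0 ≤ lSixEnstrophyConst hd / (2 * ν) := div_nonneg (lSixEnstrophyConst_nonneg hd) (by linarith)
  unfold fgtLqPrimitive
  nlinarith [mul_nonneg hc h3]

/-- **The `6 < q < ∞` line of the lower edge, primitive form.** Along a classical mean-zero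
solution on `T³` (`ν > 0`) on `[a, b]`: if `y ≥ 0` has one-sided derivatives
`y' ≤ A y (∫‖u(t)‖^q)^{1/(q−3)}` (`A ≥ 0`, `q > 6`), then `y(t) ≤ y(a) exp(A (P_q(t) − P_q(a)))`
(`(∫‖u‖^q)^{1/(q−3)} = ‖u‖_q^{q/(q−3)} ≤ ‖u‖_∞ + ‖u‖₆² ≤ P_q'`).
[cite: Protas2026, §4.1, eq. (50), p. 65 (q > 6)] [cite: RobinsonRodrigoSadowskiCUP2016, Lemma 8.15, (8.7)] -/
theorem le_mul_exp_sub_of_deriv_le_mul_rpow_integral (hd : Fintype.card d = 3) (hν : 0 < ν)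
    (hab : a < b) (h : Torus.IsClassicalNSSolutionOn (Icc a b) ν 0 u p)
    (hmean : ∀ t ∈ Icc a b, Torus.HasZeroMean (u t)) {q : ℝ} (hq : 6 < q)
    {y y' : ℝ → ℝ} {A : ℝ} (hA : 0 ≤ A)
    (hy : ∀ t ∈ Icc a b, HasDerivWithinAt y (y' t) (Icc a b) t) (hy0 : ∀ t ∈ Icc a b, 0 ≤ y t)
    (hrate : ∀ t ∈ Icc a b, y' t ≤ A * y t * (∫ x, ‖u t x‖ ^ q) ^ (1 / (q - 3)))
    {t : ℝ} (ht : t ∈ Icc a b) :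
    y t ≤ y a * Real.exp (A * (fgtLqPrimitive hd ν u t - fgtLqPrimitive hd ν u a)) := by
  refine le_mul_exp_sub_of_deriv_le_mul hy
    (fun s hs => hasDerivWithinAt_fgtLqPrimitive hd hν hab h hs) (fun s hs => ?_) ht
  have hus : Torus.IsSmooth (u s) := h.smooth_velocity.isSmooth_slice hs
  obtain ⟨x₀, hx₀⟩ := exists_forall_norm_le_norm hus.continuous
  have hU := norm_le_fgtSupBound hd hν hus (hmean s hs) x₀
  have h6 := rpow_third_integral_norm_pow_six_le_of_solution hd h hmean hs
  have hwq := rpow_integral_norm_rpow_le_add hus.continuous hq (norm_nonneg _) hx₀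
  refine (hrate s hs).trans (mul_le_mul_of_nonneg_left ?_ (mul_nonneg hA (hy0 s hs)))
  linarith

/-- **The `6 < q < ∞` line, uniform form**: `y(t) ≤ y(a) exp(A (α_ν + β(b − a) +
(γ_ν/ν + c/(2ν)) K(u(a))))` on `[a, b]`. [cite: Protas2026, §4.1, eq. (50), p. 65 (q > 6)] -/
theorem le_mul_exp_of_deriv_le_mul_rpow_integral (hd : Fintype.card d = 3) (hν : 0 < ν)
    (hab : a < b) (h : Torus.IsClassicalNSSolutionOn (Icc a b) ν 0 u p)
    (hmean : ∀ t ∈ Icc a b, Torus.HasZeroMean (u t)) {q : ℝ} (hq : 6 < q)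
    {y y' : ℝ → ℝ} {A : ℝ} (hA : 0 ≤ A)
    (hy : ∀ t ∈ Icc a b, HasDerivWithinAt y (y' t) (Icc a b) t) (hy0 : ∀ t ∈ Icc a b, 0 ≤ y t)
    (hrate : ∀ t ∈ Icc a b, y' t ≤ A * y t * (∫ x, ‖u t x‖ ^ q) ^ (1 / (q - 3)))
    {t : ℝ} (ht : t ∈ Icc a b) :
    y t ≤ y a * Real.exp (A * (fgtRateCoeff ν + fgtConstCoeff * (b - a) +
      (fgtGradCoeff ν / ν + lSixEnstrophyConst hd / (2 * ν)) * Torus.kineticEnergy (u a))) := by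
  have h1 := le_mul_exp_sub_of_deriv_le_mul_rpow_integral hd hν hab h hmean hq hA hy hy0 hrate ht
  have h2 := fgtLqPrimitive_sub_le (u := u) (a := a) (b := b) hd hν ht
  exact h1.trans (mul_le_mul_of_nonneg_left
    (Real.exp_le_exp.2 (mul_le_mul_of_nonneg_left h2 hA)) (hy0 a (left_mem_Icc.2 hab.le)))

omit [Fintype d] [DecidableEq d] in
/-- The dictionary identity for `q > 6`: `(I^{1/q})^{(2q−3)/(q−3)} = I^{1/q} · I^{1/(q−3)}`
(`I ≥ 0`), i.e. `‖u‖_q^{(2q−3)/(q−3)} = ‖u‖_q · ‖u‖_q^{q/(q−3)}`.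
[cite: Protas2026, §4.1, eq. (50), p. 65 (q > 6)] -/
theorem rpow_inv_rpow_edge_gt_six_eq {I q : ℝ} (hI : 0 ≤ I) (hq : 6 < q) :
    (I ^ (1 / q)) ^ ((2 * q - 3) / (q - 3)) = I ^ (1 / q) * I ^ (1 / (q - 3)) := by
  have hq0 : 0 < q := by linarith
  have hq3 : 0 < q - 3 := by linarith
  have hq0' : q ≠ 0 := ne_of_gt hq0
  have hq3' : q - 3 ≠ 0 := ne_of_gt hq3
  rw [← Real.rpow_mul hI, ← Real.rpow_add' hI (ne_of_gt (by positivity))]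
  congr 1
  field_simp
  ring

/-- **Literal `6 < q < ∞` edge of (50)**: with `y(t) = ‖u(t)‖_{L^q} = (∫‖u(t)‖^q)^{1/q}` and
`y' ≤ A y^{(2q−3)/(q−3)}` within `[a, b]` (`A ≥ 0`), `y(t) ≤ y(a) exp(A (α_ν + β(b − a) +
(γ_ν/ν + c/(2ν)) K(u(a))))`: the exponent `(2q−3)/(q−3)` is consistent with global regularity.
[cite: Protas2026, §4.1, eq. (50), p. 65 (q > 6)] [cite: RobinsonRodrigoSadowskiCUP2016, Lemma 8.15, (8.7)] -/
theorem lqNorm_le_mul_exp_of_rate_le_rpow_edge_gt_six (hd : Fintype.card d = 3) (hν : 0 < ν)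
    (hab : a < b) (h : Torus.IsClassicalNSSolutionOn (Icc a b) ν 0 u p)
    (hmean : ∀ t ∈ Icc a b, Torus.HasZeroMean (u t)) {q : ℝ} (hq : 6 < q)
    {y y' : ℝ → ℝ} {A : ℝ} (hA : 0 ≤ A)
    (hy : ∀ t ∈ Icc a b, HasDerivWithinAt y (y' t) (Icc a b) t)
    (hyeq : ∀ t ∈ Icc a b, y t = (∫ x, ‖u t x‖ ^ q) ^ (1 / q))
    (hrate : ∀ t ∈ Icc a b, y' t ≤ A * y t ^ ((2 * q - 3) / (q - 3))) {t : ℝ} (ht : t ∈ Icc a b) :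
    y t ≤ y a * Real.exp (A * (fgtRateCoeff ν + fgtConstCoeff * (b - a) +
      (fgtGradCoeff ν / ν + lSixEnstrophyConst hd / (2 * ν)) * Torus.kineticEnergy (u a))) := by
  have hI0 : ∀ s ∈ Icc a b, 0 ≤ ∫ x, ‖u s x‖ ^ q :=
    fun s _ => integral_nonneg fun x => Real.rpow_nonneg (norm_nonneg _) _
  have hy0 : ∀ s ∈ Icc a b, 0 ≤ y s := by
    intro s hs
    rw [hyeq s hs]
    exact Real.rpow_nonneg (hI0 s hs) _
  refine le_mul_exp_of_deriv_le_mul_rpow_integral hd hν hab h hmean hq hA hy hy0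
    (fun s hs => ?_) ht
  calc y' s ≤ A * y s ^ ((2 * q - 3) / (q - 3)) := hrate s hs
    _ = A * y s * (∫ x, ‖u s x‖ ^ q) ^ (1 / (q - 3)) := by
        rw [hyeq s hs, rpow_inv_rpow_edge_gt_six_eq (hI0 s hs) hq]
        ring

end Edge

end Literature.Analysis.FluidPDE
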